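import Summits.CriticalPhenomena.PercolationContinuityZ3.Theorems.PercNearOneGluingNoHeavyLowerTailSahiOneStepFreeBlockReduce
import HarnessLib

/-!
# One-step scheme: the costly-region reduction with ONE ODD COORDINATE — the reduced partner is still pivot-free

Support file (prover prim-ineq-prove-3 gen 53; `--supports stmt-CriticalPhenomena-4575`; memo
`run/shared/lean/prim/prim-ineq-prove-3/PROOF-G53-FREE-BLOCK.md` §5 and FINDING-G53-ONE-ODD.md).  No definitions, no named facts, no sorries,
no `native_decide`.

`…FreeBlockReduce.lift_free` needs the pivot `e` to be dominated for `B` by EVERY other coordinate of the block.  With one ODD coordinate `o`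
(a different density, so no compression between `o` and the others) this fails for `j = o`.  Here: if `e` still dominates `o` for `A`
(hypothesis `hdomA` at `j = o`), the reduced partner `B₂ = ↑(B♯ ∖ G)` is `e`-free all the same (`lift_free_odd`): above the minimal `e`-pivotal
pattern `ω` of `B₂` the only possible extra coordinate of a maximal non-member `z ∈ G` is `o`, and then `z − o + e ∈ G` agrees with
`insert e ω` on the block — contradiction.  Packaged as `exists_free_reduct_odd` (any density vector).  This is case (C1) of the one-odd-coordinate
programme of gen 53: `1 ≽_A o` ⟹ pivot at `1 = min F` with partner `B₂`, closed by MONO-A (`drift_nonneg_of_dominant`) and `drift_nonpos_of_free`.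
-/

noncomputable section

namespace Summit.CriticalPhenomena.PercolationContinuityZ3.Theorems

namespace SahiOneStep

open MeasureTheory Finset
open Literature.Probability.Percolation (DeterminedBy determinedBy_iff)
open Literature.Probability.LatticeModels (prodBernoulli)
open Literature.Probability.Percolation.DecisionTree (ind)
open scoped Classical

variable {ι : Type*} [Fintype ι]

section free

variable {F : Finset ι} {e : ι} {g : ℕ} {A B : Set (Set ι)}

/-- **THE REDUCED PARTNER DOES NOT DEPEND ON THE PIVOT — one odd coordinate allowed** (gen 53, memo PROOF-G53-FREE-BLOCK.md §5).
As `lift_free`, but one coordinate `o ∈ F` need NOT be dominated by `e` for `B`; since `e` dominates `o` for `A` (it dominates all of `F`), a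
maximal non-member of `B₂` above the minimal `e`-pivotal pattern is either the pattern itself or the pattern plus `o`, and trading `o` for `e` in
the latter lands in `G` again.  `K = insert e F`; `A` increasing, `K`-determined and
`e`-DOMINANT (`j ∈ ω ∌ e`, `ω ∈ A` ⟹ `ω − j + e ∈ A` for `j ∈ F`); `B` increasing, `K`-determined and `e`-DOMINATED; `G = A ∩ {g ≤ #(K∩ω)}`,
`B♯ = {ω | every ω' ⊇ ω in G lies in B}`, `B₂ = ↑(B♯ ∖ G)`.  Then `insert e ω ∈ B₂ → ω ∈ B₂` for every `ω ∌ e`.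
(A pattern `ω ∌ e` of minimal level with `ω + e ∈ B₂ ∌ ω` has `ω + e` minimal in `B₂`, so `ω + e ∈ B♯ ∖ G`; and `ω` is maximal outside `B₂`
(`e`-domination), which forces `ω ∈ G`; but `G` is increasing.) [this work] -/
theorem lift_free_odd (heF : e ∉ F) {o : ι} (hoF : o ∈ F) (hA : IsUpperSet A) (hAK : DeterminedBy A (↑(insert e F) : Set ι))
    (hBK : DeterminedBy B (↑(insert e F) : Set ι))
    (hdomA : ∀ j ∈ F, ∀ ω ∈ A, e ∉ ω → j ∈ ω → (ω \ {j}) ∪ {e} ∈ A)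
    (hdomB : ∀ j ∈ F, j ≠ o → ∀ ω ∈ B, e ∈ ω → j ∉ ω → (ω \ {e}) ∪ {j} ∈ B) (g : ℕ) :
    ∀ ω : Set ι, e ∉ ω →
      insert e ω ∈ {ω : Set ι | ∃ ω' : Set ι, ω' ⊆ ω ∧
          ω' ∈ {ω : Set ι | ∀ ω'' : Set ι, ω ⊆ ω'' → ω'' ∈ A ∩ {ω : Set ι | g ≤ ((insert e F).filter (· ∈ ω)).card} → ω'' ∈ B} ∧
          ω' ∉ A ∩ {ω : Set ι | g ≤ ((insert e F).filter (· ∈ ω)).card}} →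
      ω ∈ {ω : Set ι | ∃ ω' : Set ι, ω' ⊆ ω ∧
          ω' ∈ {ω : Set ι | ∀ ω'' : Set ι, ω ⊆ ω'' → ω'' ∈ A ∩ {ω : Set ι | g ≤ ((insert e F).filter (· ∈ ω)).card} → ω'' ∈ B} ∧
          ω' ∉ A ∩ {ω : Set ι | g ≤ ((insert e F).filter (· ∈ ω)).card}} := by
  set K : Finset ι := insert e F with hKdef
  set G : Set (Set ι) := A ∩ {ω : Set ι | g ≤ (K.filter (· ∈ ω)).card} with hGdef
  set Bs : Set (Set ι) := {ω : Set ι | ∀ ω'' : Set ι, ω ⊆ ω'' → ω'' ∈ G → ω'' ∈ B} with hBsdef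
  set B₂ : Set (Set ι) := {ω : Set ι | ∃ ω' : Set ι, ω' ⊆ ω ∧ ω' ∈ Bs ∧ ω' ∉ G} with hB₂def
  have heK : e ∈ K := Finset.mem_insert_self e F
  have hGup : IsUpperSet G := isUpperSet_costly hA K g
  have hGK : DeterminedBy G (↑K : Set ι) := determinedBy_costly hAK g
  have hBsup : IsUpperSet Bs := isUpperSet_hgen G B
  have hBsK : DeterminedBy Bs (↑K : Set ι) := determinedBy_hgen hGK hBK
  have hB₂up : IsUpperSet B₂ := isUpperSet_lift Bs G
  have hB₂Bs : B₂ ⊆ Bs := lift_subset hBsup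
  have hGdom : ∀ j ∈ F, ∀ ω ∈ G, e ∉ ω → j ∈ ω → (ω \ {j}) ∪ {e} ∈ G := dominant_costly hdomA
  have heo : e ≠ o := fun h => heF (h ▸ hoF)
  have hB₂dom : ∀ j ∈ F, j ≠ o → ∀ ω ∈ B₂, e ∈ ω → j ∉ ω → (ω \ {e}) ∪ {j} ∈ B₂ := by
    intro j hj hjo
    have hej : e ≠ j := fun h => heF (h ▸ hj)
    exact dominated_lift hej (hGdom j hj) (dominated_hgen_region hej (hGdom j hj) (hdomB j hj hjo))
  -- strong induction on the level of `ω`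
  suffices key : ∀ n : ℕ, ∀ ω : Set ι, e ∉ ω → (K.filter (· ∈ ω)).card = n → insert e ω ∈ B₂ → ω ∈ B₂ from
    fun ω heω h => key _ ω heω rfl h
  intro n
  induction n using Nat.strong_induction_on with
  | _ n ih =>
  intro ω heω hn hins
  by_contra hω
  -- (a) no lower `F`-neighbour of `insert e ω` lies in `B₂`
  -- (the lower neighbour is a fresh variable `ω₁ = ω ∖ {j}`, so that the level expression keeps its shape)
  have hlow : ∀ j ∈ F, j ∈ ω → ∀ ω₁ : Set ι, ω₁ = ω \ {j} → insert e ω₁ ∉ B₂ := by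
    intro j hj hjω ω₁ hω₁ hmem
    have hjK : j ∈ K := Finset.mem_insert_of_mem hj
    have hsub₁ : ω₁ ⊆ ω := by rw [hω₁]; exact Set.sdiff_subset
    have hj₁ : j ∉ ω₁ := by rw [hω₁]; exact fun h => h.2 rfl
    have he₁ : e ∉ ω₁ := fun h => heω (hsub₁ h)
    have hlt : (K.filter (· ∈ ω₁)).card < n := by
      rw [← hn]
      apply Finset.card_lt_card
      refine (Finset.ssubset_iff_of_subset fun x hx => ?_).2 ⟨j, Finset.mem_filter.2 ⟨hjK, hjω⟩, fun h => hj₁ (Finset.mem_filter.1 h).2⟩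
      rw [Finset.mem_filter] at hx ⊢
      exact ⟨hx.1, hsub₁ hx.2⟩
    have h1 : ω₁ ∈ B₂ := ih _ hlt ω₁ he₁ rfl hmem
    exact hω (hB₂up hsub₁ h1)
  -- (b) the witness of `insert e ω ∈ B₂` is `insert e ω` itself: `insert e ω ∈ B♯ ∖ G`
  obtain ⟨ω', hsub, hBs', hG'⟩ := hins
  have heω' : e ∈ ω' := by
    by_contra h
    refine hω ⟨ω', fun x hx => ?_, hBs', hG'⟩
    rcases (Set.mem_insert_iff.1 (hsub hx)) with rfl | hx'
    · exact absurd hx h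
    · exact hx'
  have hFω' : ∀ j ∈ F, j ∈ ω → j ∈ ω' := by
    intro j hj hjω
    by_contra hjω'
    refine hlow j hj hjω (ω \ {j}) rfl ⟨ω', fun x hx => ?_, hBs', hG'⟩
    rcases (Set.mem_insert_iff.1 (hsub hx)) with rfl | hx'
    · exact Set.mem_insert _ _
    · exact Set.mem_insert_of_mem _ ⟨hx', fun hxj => hjω' (hxj ▸ hx)⟩
  have hagree : insert e ω ∩ (↑K : Set ι) = ω' ∩ ↑K := by
    ext x
    simp only [Set.mem_inter_iff, Set.mem_insert_iff, Finset.mem_coe, hKdef, Finset.mem_insert]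
    constructor
    · rintro ⟨rfl | hxω, hxK⟩
      · exact ⟨heω', hxK⟩
      · rcases hxK with rfl | hxF
        · exact ⟨heω', Or.inl rfl⟩
        · exact ⟨hFω' x hxF hxω, Or.inr hxF⟩
    · rintro ⟨hxω', hxK⟩
      refine ⟨?_, hxK⟩
      rcases Set.mem_insert_iff.1 (hsub hxω') with h | h
      · exact Or.inl h
      · exact Or.inr h
  have hinsG : insert e ω ∉ G := fun h => hG' (((determinedBy_iff _ _).1 hGK _ _ hagree).1 h)
  -- (c) `ω` is maximal outside `B₂` among `K`-patterns, hence `ω ∈ G`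
  have hup : ∀ j ∈ K, j ≠ o → j ∉ ω → ω ∪ {j} ∈ B₂ := by
    intro j hj hjo hjω
    rcases Finset.mem_insert.1 hj with rfl | hjF
    · have : ω ∪ {j} = insert j ω := by ext x; simp only [Set.mem_union, Set.mem_singleton_iff, Set.mem_insert_iff]; tauto
      rw [this]; exact ⟨ω', hsub, hBs', hG'⟩
    · have hje : j ≠ e := fun h => heF (h ▸ hjF)
      have h := hB₂dom j hjF hjo (insert e ω) ⟨ω', hsub, hBs', hG'⟩ (Set.mem_insert e ω)
        (fun h => h.elim (fun h => hje h) (fun h => hjω h))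
      have heq : (insert e ω \ {e}) ∪ {j} = ω ∪ {j} := by
        ext x
        simp only [Set.mem_union, Set.mem_sdiff, Set.mem_insert_iff, Set.mem_singleton_iff]
        constructor
        · rintro (⟨rfl | hx, hxe⟩ | rfl)
          · exact absurd rfl hxe
          · exact Or.inl hx
          · exact Or.inr rfl
        · rintro (hx | rfl)
          · exact Or.inl ⟨Or.inr hx, fun hxe => heω (hxe ▸ hx)⟩
          · exact Or.inr rfl
      rw [heq] at h
      exact h
  have hωG : ω ∈ G := by
    by_cases hωBs : ω ∈ Bs
    · by_contra hG
      exact hω ⟨ω, subset_rfl, hωBs, hG⟩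
    · have hex : ∃ z : Set ι, ω ⊆ z ∧ z ∈ G ∧ z ∉ B := by
        by_contra h
        push Not at h
        exact hωBs fun z hz hzG => h z hz hzG
      obtain ⟨z, hωz, hzG, hzB⟩ := hex
      have hagree' : ω ∩ (↑K : Set ι) = z ∩ ↑K := by
        ext x
        simp only [Set.mem_inter_iff, Finset.mem_coe]
        constructor
        · rintro ⟨hx, hxK⟩
          exact ⟨hωz hx, hxK⟩
        · rintro ⟨hxz, hxK⟩
          refine ⟨?_, hxK⟩
          by_contra hxω
          by_cases hxo : x = o
          · -- the odd coordinate: `e ∉ z`, and trading `o` for `e` in `z` puts `insert e ω` into `G`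
            have hoz : o ∈ z := hxo ▸ hxz
            have hoω : o ∉ ω := hxo ▸ hxω
            have hez : e ∉ z := fun hez =>
              hzB ((hBsup (Set.union_subset hωz (Set.singleton_subset_iff.2 hez)) (hB₂Bs (hup e heK heo heω))) z subset_rfl hzG)
            have hz' : (z \ {o}) ∪ {e} ∈ G := hGdom o hoF z hzG hez hoz
            have hagree2 : ((z \ {o}) ∪ {e}) ∩ (↑K : Set ι) = insert e ω ∩ ↑K := by
              ext i
              simp only [Set.mem_inter_iff, Set.mem_union, Set.mem_sdiff, Set.mem_singleton_iff, Set.mem_insert_iff, Finset.mem_coe]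
              constructor
              · rintro ⟨⟨hiz, hio⟩ | rfl, hiK⟩
                · refine ⟨Or.inr ?_, hiK⟩
                  by_contra hiω
                  exact hzB ((hBsup (Set.union_subset hωz (Set.singleton_subset_iff.2 hiz)) (hB₂Bs (hup i hiK hio hiω))) z subset_rfl hzG)
                · exact ⟨Or.inl rfl, hiK⟩
              · rintro ⟨rfl | hiω, hiK⟩
                · exact ⟨Or.inr rfl, hiK⟩
                · exact ⟨Or.inl ⟨hωz hiω, fun hio => hoω (hio ▸ hiω)⟩, hiK⟩
            exact hinsG (((determinedBy_iff _ _).1 hGK _ _ hagree2).1 hz')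
          · have h1 : ω ∪ {x} ∈ Bs := hB₂Bs (hup x hxK hxo hxω)
            have h2 : z ∈ Bs := hBsup (Set.union_subset hωz (Set.singleton_subset_iff.2 hxz)) h1
            exact hzB (h2 z subset_rfl hzG)
      exact ((determinedBy_iff _ _).1 hGK _ _ hagree').2 hzG
  exact hinsG (hGup (Set.subset_insert e ω) hωG)

end free

/-- **COSTLY-REGION REDUCTION, one odd coordinate allowed** (gen 53).  As `exists_free_reduct`, with one `o ∈ F` exempt from
`e`-domination of `B`.  Slot `Th_{t+1}(insert e S')` with `insert e F ⊆ insert e S'` (`e ∉ S'`, `F ⊆ S'`),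
ANY density vector; `A, B` increasing, `insert e F`-determined, `A` `e`-dominant and `B` `e`-dominated over `F`.  Then there is an increasing
`insert e F`-determined `B₂` NOT DEPENDING ON `e` with `n(A, B₂) ≤ n(A, B)`. [this work] -/
theorem exists_free_reduct_odd (p : ι → unitInterval) {F S' : Finset ι} {e o : ι} (heS' : e ∉ S') (hFS' : F ⊆ S') (hoF : o ∈ F) (t : ℕ)
    {A B : Set (Set ι)} (hA : IsUpperSet A) (hB : IsUpperSet B)
    (hAF : DeterminedBy A (↑(insert e F) : Set ι)) (hBF : DeterminedBy B (↑(insert e F) : Set ι))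
    (hdomA : ∀ j ∈ F, ∀ ω ∈ A, e ∉ ω → j ∈ ω → (ω \ {j}) ∪ {e} ∈ A)
    (hdomB : ∀ j ∈ F, j ≠ o → ∀ ω ∈ B, e ∈ ω → j ∉ ω → (ω \ {e}) ∪ {j} ∈ B) :
    ∃ B₂ : Set (Set ι), IsUpperSet B₂ ∧ DeterminedBy B₂ (↑(insert e F) : Set ι) ∧
      (∀ ω : Set ι, insert e ω ∈ B₂ ↔ ω \ {e} ∈ B₂) ∧
      osN p {ω : Set ι | t + 1 ≤ ((insert e S').filter (· ∈ ω)).card} (ind A) (ind B₂) ≤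
        osN p {ω : Set ι | t + 1 ≤ ((insert e S').filter (· ∈ ω)).card} (ind A) (ind B) := by
  set K : Finset ι := insert e F with hKdef
  set S : Finset ι := insert e S' with hSdef
  have heF : e ∉ F := fun h => heS' (hFS' h)
  have hKS : K ⊆ S := Finset.insert_subset_insert e hFS'
  -- the costly level `g`
  have hex : ∃ k : ℕ, (prodBernoulli p).real {ω : Set ι | ((S \ K).filter (· ∈ ω)).card + k < t + 1} *
        (prodBernoulli p).real (Aᶜ ∩ {ω : Set ι | (S.filter (· ∈ ω)).card < t + 1}) ≤
      (prodBernoulli p).real {ω : Set ι | (S.filter (· ∈ ω)).card < t + 1} * (1 - (prodBernoulli p).real A) :=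
    ⟨t + 1, by
      rw [real_shiftedBall_self, zero_mul]
      exact mul_nonneg measureReal_nonneg (sub_nonneg.2 measureReal_le_one)⟩
  set g : ℕ := Nat.find hex with hgdef
  have hcost := Nat.find_spec hex
  have hfree : ∀ k < g, (prodBernoulli p).real {ω : Set ι | (S.filter (· ∈ ω)).card < t + 1} * (1 - (prodBernoulli p).real A) ≤
      (prodBernoulli p).real {ω : Set ι | ((S \ K).filter (· ∈ ω)).card + k < t + 1} *
        (prodBernoulli p).real (Aᶜ ∩ {ω : Set ι | (S.filter (· ∈ ω)).card < t + 1}) :=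
    fun k hk => le_of_lt (not_le.1 (Nat.find_min hex hk))
  set G : Set (Set ι) := A ∩ {ω : Set ι | g ≤ (K.filter (· ∈ ω)).card} with hGdef
  set Bs : Set (Set ι) := {ω : Set ι | ∀ ω'' : Set ι, ω ⊆ ω'' → ω'' ∈ G → ω'' ∈ B} with hBsdef
  set B₂ : Set (Set ι) := {ω : Set ι | ∃ ω' : Set ι, ω' ⊆ ω ∧ ω' ∈ Bs ∧ ω' ∉ G} with hB₂def
  have hGK : DeterminedBy G (↑K : Set ι) := determinedBy_costly hAF g
  have hBsup : IsUpperSet Bs := isUpperSet_hgen G B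
  have hBsK : DeterminedBy Bs (↑K : Set ι) := determinedBy_hgen hGK hBF
  have hB₂up : IsUpperSet B₂ := isUpperSet_lift Bs G
  refine ⟨B₂, hB₂up, determinedBy_lift hBsK hGK, fun ω => ⟨fun h => ?_, fun h => ?_⟩, ?_⟩
  · have h' : insert e (ω \ {e}) ∈ B₂ := by rwa [Set.insert_sdiff_singleton]
    exact lift_free_odd heF hoF hA hAF hBF hdomA hdomB g (ω \ {e}) (fun h => h.2 rfl) h'
  · exact hB₂up (Set.sdiff_subset.trans (Set.subset_insert e ω)) h
  · exact (osN_lift_le p hKS (t + 1) hBsup hAF hBsK g hcost).trans (osN_sharp_le p hKS (t + 1) hA hB hAF hBF g hfree)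


end SahiOneStep

end Summit.CriticalPhenomena.PercolationContinuityZ3.Theorems
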